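import Literature.AnabelianGeometry.SemiGraphs.TemperedPiLevelDataOfTower
import Literature.AnabelianGeometry.SemiGraphs.TemperedNoFixedBranchPair

/-!
# The identification (I4′) forces the finite-level actions to be jointly faithful

[SemiAnbd] Thm. 3.7 (iii), proof p. 41 [cite: MochizukiSemiAnbd2006, Thm 3.7(iii) p.41] with the
author's *Comments* (2020) item (6).  The cell's finite-level data `FiniteLevelData` (seat
abc-iut-L3-t10, `TemperedLevelData.lean`) carries ONE anabelioid axiom, the branch-level
identification (I4′) `stabBranchPair'` (Remark 2.2.1 at branch level, ruling ν2), which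
abc-iut-L3-t11's `noFixedBranchPairSystem_of_isTotallyEstranged(')` combines with total estrangement.

This proof-only file records a CONSEQUENCE of the field as typed (finding F-t6g3-1 of seat
abc-iut-L3-t6): over a totally estranged `𝒢`, (I4′) makes EVERY element of the chart group that
fixes a compatible finite-level branch-pair system trivial (`eq_one_of_stabBranchPair'`) — not only
the elements of a compact subgroup.  Consequently the level actions of a `FiniteLevelData` are
jointly faithful past any level carrying such a system (`FiniteLevelData.eq_one_of_levelAct_eq_one`),
and for Galois level data `D` (abc-iut-L3-t9's tower) the (I4′) input of
`GaloisLevelData.finiteLevelDataOfTower` is REFUTED by any nontrivial element acting trivially on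
every finite level `𝔾_{S n}` (`GaloisLevelData.not_stabBranchPair'_of_levelAct_eq_one`) — e.g. a
nontrivial compatible family of deck transformations, which exists whenever the finite levels
`S n` are not cofinal among the finite étale coverings (print, p. 41, works with "the projective
system of connected finite étale Galois coverings", a cofinal system, inside `π̂₁`).  Nothing here
bears on [IUTchIII] Cor. 3.12; it constrains OUR decomposition, not print.
-/

namespace Literature.AnabelianGeometry.SemiGraphs

namespace ProfiniteSemiGraph

open CategoryTheory Topology

universe v u

variable {𝒢 : ProfiniteSemiGraph.{u}}

/-- **(I4′) + total estrangement ⇒ every element fixing a compatible finite-level branch-pair system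
is trivial** (the element-wise content of `noFixedBranchPairSystem_of_isTotallyEstranged'`, for the
field shape of `FiniteLevelData.stabBranchPair'`; no compactness of the element's closure is used —
which is the point of finding F-t6g3-1). [cite: MochizukiSemiAnbd2006, Thm 3.7(iii) p.41] -/
theorem eq_one_of_stabBranchPair' (hest : 𝒢.IsTotallyEstranged) (c : TemperedPiChart 𝒢)
    {J : Type v} [Preorder J] (level : J → SemiGraph.{u}) (levelAct : ∀ j, c.G →* Aut (level j))
    (levelTrans : ∀ ⦃i j : J⦄, i ≤ j → (level j ⟶ level i))
    (stabBranchPair' : ∀ (j₀ : J) (w : ∀ i : {i : J // j₀ ≤ i}, (level i.1).Vertex)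
      (β β' : ∀ i : {i : J // j₀ ≤ i}, (level i.1).Branch),
      (∀ i, β i ≠ β' i ∧ (level i.1).abuts (β i) = some (w i) ∧ (level i.1).abuts (β' i) = some (w i)) →
      (∀ ⦃i i' : {i : J // j₀ ≤ i}⦄ (h : i.1 ≤ i'.1), (levelTrans h).vertexMap (w i') = w i ∧
        (levelTrans h).branchMap (β i') = β i ∧ (levelTrans h).branchMap (β' i') = β' i) →
      ∃ (Q : Type u) (_ : Group Q) (ιQ : c.G →* Q) (v : 𝒢.graph.Vertex) (b b' : 𝒢.graph.Branch)
        (hb : 𝒢.graph.abuts b = some v) (hb' : 𝒢.graph.abuts b' = some v) (ψ : 𝒢.Gv v →* Q) (x x' : 𝒢.Gv v),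
        Function.Injective ιQ ∧ Function.Injective ψ ∧ (b' ≠ b ∨ x⁻¹ * x' ∉ 𝒢.branchSubgroup b v hb) ∧
        ∀ g : c.G, (∀ i, (levelAct i.1 g).hom.vertexMap (w i) = w i ∧
          (levelAct i.1 g).hom.branchMap (β i) = β i ∧ (levelAct i.1 g).hom.branchMap (β' i) = β' i) →
          ιQ g ∈ ((𝒢.branchSubgroup b v hb).map (MulAut.conj x).toMonoidHom).map ψ ⊓
            ((𝒢.branchSubgroup b' v hb').map (MulAut.conj x').toMonoidHom).map ψ)
    (j₀ : J) (w : ∀ i : {i : J // j₀ ≤ i}, (level i.1).Vertex)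
    (β β' : ∀ i : {i : J // j₀ ≤ i}, (level i.1).Branch)
    (hpair : ∀ i, β i ≠ β' i ∧ (level i.1).abuts (β i) = some (w i) ∧ (level i.1).abuts (β' i) = some (w i))
    (hcompat : ∀ ⦃i i' : {i : J // j₀ ≤ i}⦄ (h : i.1 ≤ i'.1), (levelTrans h).vertexMap (w i') = w i ∧
      (levelTrans h).branchMap (β i') = β i ∧ (levelTrans h).branchMap (β' i') = β' i)
    (g : c.G)
    (hfix : ∀ i : {i : J // j₀ ≤ i}, (levelAct i.1 g).hom.vertexMap (w i) = w i ∧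
      (levelAct i.1 g).hom.branchMap (β i) = β i ∧ (levelAct i.1 g).hom.branchMap (β' i) = β' i) :
    g = 1 := by
  obtain ⟨Q, _, ιQ, v, b, b', hb, hb', ψ, x, x', hι, hψ, hne, hstab⟩ :=
    stabBranchPair' j₀ w β β' hpair hcompat
  -- total estrangement of the edge of `b` at `v`: `Π_b ∩ (x⁻¹x')·Π_{b'}·(x⁻¹x')⁻¹ = 1`
  have hest' := (hest (𝒢.graph.edgeOf b)).2 b rfl v hb b' hb' (x⁻¹ * x') hne
  have hbot := map_conj_inf_map_conj_eq_bot ψ hψ _ _ x x' hest'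
  have hmem := hstab g hfix
  rw [hbot, Subgroup.mem_bot] at hmem
  exact hι (by rw [hmem, map_one])

namespace FiniteLevelData

variable {c : TemperedPiChart 𝒢} (D : FiniteLevelData.{v} 𝒢 c)

/-- **For finite-level data over a totally estranged `𝒢`, every element of the chart group fixing a
compatible finite-level branch-pair system `(w_i; β_i ≠ β'_i)_{i ≥ j₀}` is trivial** (field (I4′) +
estrangement). [cite: MochizukiSemiAnbd2006, Thm 3.7(iii) p.41] -/
theorem eq_one_of_fixes_branchPairSystem (hest : 𝒢.IsTotallyEstranged) (j₀ : D.J)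
    (w : ∀ i : {i : D.J // j₀ ≤ i}, (D.level i.1).Vertex)
    (β β' : ∀ i : {i : D.J // j₀ ≤ i}, (D.level i.1).Branch)
    (hpair : ∀ i, β i ≠ β' i ∧ (D.level i.1).abuts (β i) = some (w i) ∧
      (D.level i.1).abuts (β' i) = some (w i))
    (hcompat : ∀ ⦃i i' : {i : D.J // j₀ ≤ i}⦄ (h : i.1 ≤ i'.1), (D.levelTrans h).vertexMap (w i') = w i ∧
      (D.levelTrans h).branchMap (β i') = β i ∧ (D.levelTrans h).branchMap (β' i') = β' i)
    (g : c.G)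
    (hfix : ∀ i : {i : D.J // j₀ ≤ i}, (D.levelAct i.1 g).hom.vertexMap (w i) = w i ∧
      (D.levelAct i.1 g).hom.branchMap (β i) = β i ∧ (D.levelAct i.1 g).hom.branchMap (β' i) = β' i) :
    g = 1 :=
  eq_one_of_stabBranchPair' hest c D.level D.levelAct D.levelTrans D.stabBranchPair' j₀ w β β' hpair
    hcompat g hfix

/-- **The level actions of finite-level data are jointly faithful past any level carrying a compatible
branch-pair system**: an element acting trivially on every finite level `𝔾_j`, `j ≥ j₀`, is trivial
(`𝒢` totally estranged). In particular finite-level data can only exist for level systems whose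
joint kernel `⋂_j ker (levelAct j)` is trivial (finding F-t6g3-1). [cite: MochizukiSemiAnbd2006, Thm 3.7(iii) p.41] -/
theorem eq_one_of_levelAct_eq_one (hest : 𝒢.IsTotallyEstranged) (j₀ : D.J)
    (w : ∀ i : {i : D.J // j₀ ≤ i}, (D.level i.1).Vertex)
    (β β' : ∀ i : {i : D.J // j₀ ≤ i}, (D.level i.1).Branch)
    (hpair : ∀ i, β i ≠ β' i ∧ (D.level i.1).abuts (β i) = some (w i) ∧
      (D.level i.1).abuts (β' i) = some (w i))
    (hcompat : ∀ ⦃i i' : {i : D.J // j₀ ≤ i}⦄ (h : i.1 ≤ i'.1), (D.levelTrans h).vertexMap (w i') = w i ∧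
      (D.levelTrans h).branchMap (β i') = β i ∧ (D.levelTrans h).branchMap (β' i') = β' i)
    (g : c.G) (htriv : ∀ j : D.J, j₀ ≤ j → D.levelAct j g = 1) : g = 1 := by
  refine D.eq_one_of_fixes_branchPairSystem hest j₀ w β β' hpair hcompat g fun i => ?_
  have h1 : (D.levelAct i.1 g).hom = 𝟙 (D.level i.1) := by rw [htriv i.1 i.2]; rfl
  simp only [h1, SemiGraph.id_vertexMap, SemiGraph.id_branchMap, id_eq, and_self]

end FiniteLevelData

namespace GaloisLevelData

variable (D : GaloisLevelData 𝒢) (h𝒢 : 𝒢.IsCountable) (c : TemperedPiChart 𝒢)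
  (ρ : c.G →* D.temperedPi h𝒢) (hconn : ∀ (n : ℕ) (p q : (D.S n).Point), (D.S n).SameComponent p q)

/-- **The (I4′) input of `GaloisLevelData.finiteLevelDataOfTower` is refuted by any nontrivial element
of the chart group acting trivially on every finite level `𝔾_{S n}`** (`𝒢` totally estranged; one
compatible finite-level branch-pair system given).  For Galois level data whose finite levels `S n`
are NOT cofinal among the finite étale coverings — a tower over a Galois-countability witness need
not be — a nontrivial compatible family of deck transformations of the `𝒢_{∞,S n} → S n` is such an
element (for `ρ` the identity of `π₁^temp`), so the identification must then be sought for compact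
stabilisers only (finding F-t6g3-1). [cite: MochizukiSemiAnbd2006, Thm 3.7(iii) p.41] -/
theorem not_stabBranchPair'_of_levelAct_eq_one (hest : 𝒢.IsTotallyEstranged) (g : c.G) (hg : g ≠ 1)
    (htriv : ∀ n, D.levelAct h𝒢 hconn n (ρ g) = 1) (j₀ : ℕ)
    (w : ∀ i : {i : ℕ // j₀ ≤ i}, (D.S i.1).orbitGraph.Vertex)
    (β β' : ∀ i : {i : ℕ // j₀ ≤ i}, (D.S i.1).orbitGraph.Branch)
    (hpair : ∀ i, β i ≠ β' i ∧ (D.S i.1).orbitGraph.abuts (β i) = some (w i) ∧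
      (D.S i.1).orbitGraph.abuts (β' i) = some (w i))
    (hcompat : ∀ ⦃i i' : {i : ℕ // j₀ ≤ i}⦄ (h : i.1 ≤ i'.1), (D.levelTrans h).vertexMap (w i') = w i ∧
      (D.levelTrans h).branchMap (β i') = β i ∧ (D.levelTrans h).branchMap (β' i') = β' i) :
    ¬ ∀ (j₀ : ℕ) (w : ∀ i : {i : ℕ // j₀ ≤ i}, (D.S i.1).orbitGraph.Vertex)
      (β β' : ∀ i : {i : ℕ // j₀ ≤ i}, (D.S i.1).orbitGraph.Branch),
      (∀ i, β i ≠ β' i ∧ (D.S i.1).orbitGraph.abuts (β i) = some (w i) ∧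
        (D.S i.1).orbitGraph.abuts (β' i) = some (w i)) →
      (∀ ⦃i i' : {i : ℕ // j₀ ≤ i}⦄ (h : i.1 ≤ i'.1), (D.levelTrans h).vertexMap (w i') = w i ∧
        (D.levelTrans h).branchMap (β i') = β i ∧ (D.levelTrans h).branchMap (β' i') = β' i) →
      ∃ (Q : Type u) (_ : Group Q) (ιQ : c.G →* Q) (v : 𝒢.graph.Vertex) (b b' : 𝒢.graph.Branch)
        (hb : 𝒢.graph.abuts b = some v) (hb' : 𝒢.graph.abuts b' = some v) (ψ : 𝒢.Gv v →* Q)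
        (x x' : 𝒢.Gv v),
        Function.Injective ιQ ∧ Function.Injective ψ ∧ (b' ≠ b ∨ x⁻¹ * x' ∉ 𝒢.branchSubgroup b v hb) ∧
        ∀ g : c.G, (∀ i, (D.levelAct h𝒢 hconn i.1 (ρ g)).hom.vertexMap (w i) = w i ∧
          (D.levelAct h𝒢 hconn i.1 (ρ g)).hom.branchMap (β i) = β i ∧
          (D.levelAct h𝒢 hconn i.1 (ρ g)).hom.branchMap (β' i) = β' i) →
          ιQ g ∈ ((𝒢.branchSubgroup b v hb).map (MulAut.conj x).toMonoidHom).map ψ ⊓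
            ((𝒢.branchSubgroup b' v hb').map (MulAut.conj x').toMonoidHom).map ψ := by
  intro sbp
  refine hg (eq_one_of_stabBranchPair' hest c (fun n => (D.S n).orbitGraph)
    (fun n => (D.levelAct h𝒢 hconn n).comp ρ) (fun _ _ h => D.levelTrans h) sbp j₀ w β β' hpair
    hcompat g fun i => ?_)
  have h1 : (D.levelAct h𝒢 hconn i.1 (ρ g)).hom = 𝟙 (D.S i.1).orbitGraph := by rw [htriv i.1]; rfl
  simp only [MonoidHom.comp_apply, h1, SemiGraph.id_vertexMap, SemiGraph.id_branchMap, id_eq, and_self]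

/-- **Equivalently: the (I4′) input of `finiteLevelDataOfTower` (with a compatible branch-pair system
in the levels, `𝒢` totally estranged) forces `⋂ₙ ker (levelAct n ∘ ρ) = 1`** — the chart group must act
jointly faithfully on the finite levels of the tower, i.e. the finite levels must separate the chart
group (a cofinality-type condition on the tower, not supplied by Galois-countability).
[cite: MochizukiSemiAnbd2006, Thm 3.7(iii) p.41] -/
theorem eq_one_of_levelAct_eq_one_of_stabBranchPair' (hest : 𝒢.IsTotallyEstranged) (j₀ : ℕ)
    (w : ∀ i : {i : ℕ // j₀ ≤ i}, (D.S i.1).orbitGraph.Vertex)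
    (β β' : ∀ i : {i : ℕ // j₀ ≤ i}, (D.S i.1).orbitGraph.Branch)
    (hpair : ∀ i, β i ≠ β' i ∧ (D.S i.1).orbitGraph.abuts (β i) = some (w i) ∧
      (D.S i.1).orbitGraph.abuts (β' i) = some (w i))
    (hcompat : ∀ ⦃i i' : {i : ℕ // j₀ ≤ i}⦄ (h : i.1 ≤ i'.1), (D.levelTrans h).vertexMap (w i') = w i ∧
      (D.levelTrans h).branchMap (β i') = β i ∧ (D.levelTrans h).branchMap (β' i') = β' i)
    (sbp : ∀ (j₀ : ℕ) (w : ∀ i : {i : ℕ // j₀ ≤ i}, (D.S i.1).orbitGraph.Vertex)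
      (β β' : ∀ i : {i : ℕ // j₀ ≤ i}, (D.S i.1).orbitGraph.Branch),
      (∀ i, β i ≠ β' i ∧ (D.S i.1).orbitGraph.abuts (β i) = some (w i) ∧
        (D.S i.1).orbitGraph.abuts (β' i) = some (w i)) →
      (∀ ⦃i i' : {i : ℕ // j₀ ≤ i}⦄ (h : i.1 ≤ i'.1), (D.levelTrans h).vertexMap (w i') = w i ∧
        (D.levelTrans h).branchMap (β i') = β i ∧ (D.levelTrans h).branchMap (β' i') = β' i) →
      ∃ (Q : Type u) (_ : Group Q) (ιQ : c.G →* Q) (v : 𝒢.graph.Vertex) (b b' : 𝒢.graph.Branch)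
        (hb : 𝒢.graph.abuts b = some v) (hb' : 𝒢.graph.abuts b' = some v) (ψ : 𝒢.Gv v →* Q)
        (x x' : 𝒢.Gv v),
        Function.Injective ιQ ∧ Function.Injective ψ ∧ (b' ≠ b ∨ x⁻¹ * x' ∉ 𝒢.branchSubgroup b v hb) ∧
        ∀ g : c.G, (∀ i, (D.levelAct h𝒢 hconn i.1 (ρ g)).hom.vertexMap (w i) = w i ∧
          (D.levelAct h𝒢 hconn i.1 (ρ g)).hom.branchMap (β i) = β i ∧
          (D.levelAct h𝒢 hconn i.1 (ρ g)).hom.branchMap (β' i) = β' i) →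
          ιQ g ∈ ((𝒢.branchSubgroup b v hb).map (MulAut.conj x).toMonoidHom).map ψ ⊓
            ((𝒢.branchSubgroup b' v hb').map (MulAut.conj x').toMonoidHom).map ψ)
    (g : c.G) (htriv : ∀ n, D.levelAct h𝒢 hconn n (ρ g) = 1) : g = 1 := by
  by_contra hg
  exact D.not_stabBranchPair'_of_levelAct_eq_one h𝒢 c ρ hconn hest g hg htriv j₀ w β β' hpair hcompat sbp

end GaloisLevelData

end ProfiniteSemiGraph

end Literature.AnabelianGeometry.SemiGraphs
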